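import Literature.NumberTheory.EllipticCurves.TwoDescentKummerBridgeAdditivePlace
import Literature.NumberTheory.EllipticCurves.TwoDescentKummerBridgeRealPlace
import Literature.NumberTheory.EllipticCurves.TwoDescentLocalTwoCN
import HarnessLib

/-!
# The `2`-adic condition on Selmer classes of `y² = (x + n) x (x − n)`, `n = 2m`, `m` odd

The tree's `TwoDescentLocalTwoCN.local_condition_two_cn` is the `2`-adic condition of the complete
`2`-descent on the congruent-number-type curves `E : y² = (x + n)·x·(x − n)`, `n = 2m`, `m` odd
(Silverman AEC Example X.1.5 in elementary form): for RATIONAL points `(x, y)`, `y ≠ 0`,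
`v₂(x + n) ≡ χ₄(x) + χ₄(m)·v₂(x) (mod 2)`. This file proves the same relation for `ℚ₂`-POINTS (the
residue-mod-`8` bookkeeping of the rational proof runs verbatim on `ℚ_[2]` with the tree's `pres8` / `pc4`
of `TwoDescentLocalPadic.lean`) and carries it over to SELMER classes through the joint local
descent–Kummer bridge (`TwoDescentKummerBridgeAdditivePlace.exists_twoDescentComponent_pair_eq_of_mem_selmerGroup`)
at the place `2`, where the completion `v.adicCompletion ℚ` is Mathlib's `padicEquiv v : ≃A[ℚ] ℚ_[ℓ]`,
`ℓ = primesEquiv v = 2`: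

* `local_condition_two_cn_padic` — the relation for `ℚ₂`-points with `y ≠ 0`;
* `local_condition_two_cn_of_twoDescentComponent_eq` — for ALL points (incl. `O` and `E[2]`) of a curve
  with `2`-torsion `−n, 0, n` over any field `F` with a ring homomorphism `φ : F →+* ℚ_[p]`, `p = 2`, on
  representatives `a, b` of the two descent components (read in `ℚ_[p]` through `φ`);
* `parityBit_two_eq_of_mem_selmerGroup_cn` — **for `E/ℚ` with rational `2`-torsion `−n, 0, n`, `n = 2m`, `m`
  odd, and `c ∈ Sel⁽²⁾(E/ℚ)` with global components `[a]`, `[b]`: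
  `parityBit 2 a = chi4 b + chi4 m · parityBit 2 b`** — the `2`-adic linear condition of a `2`-Selmer
  computation in the currency of the tree's rank computations (`CongruentNumberEvenFiveThreeRankBound.kill_53`).

Theorems only; no named fact. Cell `bsd-monsky` (towards `#Sel⁽²⁾(E_{2pq}/ℚ) ≤ 8` on the half `(p/q) = +1`,
`q ≡ 7 (mod 8)`, where the places `p`, `q`, `∞` do not suffice).

## References

* [SilvermanAEC2009] J. H. Silverman, *The Arithmetic of Elliptic Curves*, 2nd ed., GTM 106,
  Springer 2009, Prop. X.1.4, Example X.1.5 (`ℚ₂ˣ/ℚ₂ˣ²`), Prop. X.4.9.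
-/

noncomputable section

open scoped Classical

open WeierstrassCurve.Affine WeierstrassCurve.Affine.Point

namespace Literature.NumberTheory.EllipticCurves.TwoDescentLocal

open Literature.NumberTheory.EllipticCurves.KramerTwoDescent

/-! ## The `2`-adic condition on `ℚ₂`-points -/

/-- **The `2`-adic condition on `E_n : y² = (x + n) x (x − n)`, `n = 2m`, `m` odd, for `ℚ₂`-POINTS**: for
`x, y ∈ ℚ₂` with `y ≠ 0` on the curve, `v₂(x + n) ≡ χ₄(x) + χ₄(m)·v₂(x) (mod 2)` — the rational proof of
`local_condition_two_cn` (cases `v₂(x) < 0`, `= 0`, `= 1`, `≥ 2` on residues mod `8`) run in `ℚ₂`.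
[cite: SilvermanAEC2009, Example X.1.5] -/
theorem local_condition_two_cn_padic {m : ℤ} (hm : Odd m) {n : ℚ} (hn : n = 2 * m) {x y : ℚ_[2]}
    (h : y ^ 2 = (x - -(n : ℚ_[2])) * (x - 0) * (x - (n : ℚ_[2]))) (hy : y ≠ 0) :
    (padicPlace 2).parity (x - -(n : ℚ_[2])) =
      pc4 (x - 0) + chi4 (m : ℚ) * (padicPlace 2).parity (x - 0) := by
  haveI : Fact (Nat.Prime 2) := ⟨Nat.prime_two⟩
  set 𝔳 : OddPlace ℚ_[2] := padicPlace 2 with h𝔳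
  obtain ⟨hd₁, hd₂, hd₃⟩ := OddPlace.factors_ne_zero' hy h
  have hsum := OddPlace.even_sum_v (𝔳 := 𝔳) hy h
  rw [sub_zero] at hd₂ h hsum ⊢
  have hm2 : ¬ (2 : ℤ) ∣ m := by rcases hm with ⟨k, rfl⟩; omega
  have hm0 : (m : ℚ) ≠ 0 := by exact_mod_cast (show m ≠ 0 by rintro rfl; exact hm2 ⟨0, rfl⟩)
  have hn0 : n ≠ 0 := by rw [hn]; exact mul_ne_zero two_ne_zero hm0
  set N : ℚ_[2] := (n : ℚ_[2]) with hN
  have hN0 : N ≠ 0 := by rw [hN]; exact_mod_cast hn0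
  have hNn0 : -N ≠ 0 := neg_ne_zero.mpr hN0
  -- valuations of the constants
  have hvm : padicValRat 2 (m : ℚ) = 0 := padicValRat_intCast_eq_zero (by exact_mod_cast hm2)
  have hvnQ : padicValRat 2 n = 1 := by
    rw [hn, padicValRat.mul two_ne_zero hm0, hvm, show (2 : ℚ) = ((2 : ℕ) : ℚ) from rfl,
      padicValRat.self one_lt_two]; rfl
  have hvn : 𝔳.v N = 1 := by rw [hN, h𝔳, padicPlace_v_ratCast, hvnQ]
  have hvnn : 𝔳.v (-N) = 1 := by rw [𝔳.v_neg, hvn]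
  -- residues of the constants
  set s := res8 (m : ℚ) with hs
  have hss : s * s = 1 := res8_mul_self hm0
  have hrnQ : res8 n = s := by
    rw [hn, show (2 : ℚ) * m = (2 : ℚ) ^ (1 : ℤ) * m by ring, res8_two_zpow_mul 1 hm0]
  have hrn : pres8 N = s := by rw [hN, pres8_ratCast, hrnQ]
  have hrnn : pres8 (-N) = ((-1 : ℤ) : ZMod (2 ^ 3)) * s := by
    rw [show -N = (((-1 : ℤ) : ℚ) : ℚ_[2]) * N by push_cast; ring, pres8_mul (by norm_num) hN0, hrn,
      pres8_ratCast, res8_intCast (by decide)]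
  have hcm : chi4 (m : ℚ) = chi4Of s := rfl
  -- the product relation `pres8 (x+n) · pres8 x · pres8 (x-n) = 1`
  set r := pres8 x with hr
  have hrr : r * r = 1 := pres8_mul_self hd₂
  have hprod : pres8 (x - -N) * r * pres8 (x - N) = 1 := by
    have h1 : pres8 (y ^ 2) = pres8 (x - -N) * r * pres8 (x - N) := by
      rw [h, pres8_mul (mul_ne_zero hd₁ hd₂) hd₃, pres8_mul hd₁ hd₂]
    rw [← h1, sq, pres8_mul hy hy, pres8_mul_self hy]
  obtain ⟨aux_A, aux_B, aux_C1, aux_C2, aux_D1, aux_D2⟩ := zmod8_cn_aux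
  have hx₁ : x - -N = x + N := by ring
  have hx₃ : x - N = x + -N := by ring
  have p0 : ∀ {t : ℚ_[2]}, Even (𝔳.v t) → 𝔳.parity t = 0 := fun ht => (𝔳.parity_eq_zero_iff _).mpr ht
  have p1 : ∀ {t : ℚ_[2]}, Odd (𝔳.v t) → 𝔳.parity t = 1 := fun ht =>
    𝔳.parity_eq_one_of_not_even (fun he => (Int.not_odd_iff_even.mpr he) ht)
  set v := 𝔳.v x with hv
  rcases lt_trichotomy v 0 with hneg | hzero | hpos
  · -- Case `v₂(x) < 0`
    have hv₁ : 𝔳.v (x - -N) = v := by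
      rw [hx₁]; exact (𝔳.add_eq_left_of_lt hd₂ hN0 (by rw [hvn]; omega)).2
    have hv₃ : 𝔳.v (x - N) = v := by
      rw [hx₃]; exact (𝔳.add_eq_left_of_lt hd₂ hNn0 (by rw [hvnn]; omega)).2
    rw [hv₁, hv₃] at hsum
    have heven : Even v := by obtain ⟨k, hk⟩ := hsum; exact ⟨k - v, by omega⟩
    obtain ⟨j, hj⟩ := heven
    obtain ⟨k, hk⟩ := Int.eq_ofNat_of_zero_le (show (0 : ℤ) ≤ 1 - v by omega)
    have hk3 : 3 ≤ k := by omega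
    have hk1 : (1 : ℤ) = v + k := by omega
    have heven : Even v := ⟨j, hj⟩
    have h2k : (2 : ZMod (2 ^ 3)) ^ k = 0 := by
      obtain ⟨i, rfl⟩ := Nat.exists_eq_add_of_le hk3
      rw [pow_add, show (2 : ZMod (2 ^ 3)) ^ 3 = 0 from rfl, zero_mul]
    have hr₁ : pres8 (x - -N) = r := by
      rw [hx₁, pres8_add_of_eq hd₂ (k := k) (by omega) (by rw [← padicPlace_v, ← padicPlace_v, hvn]; exact hk1),
        h2k, zero_mul, add_zero]
    have hr₃ : pres8 (x - N) = r := by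
      rw [hx₃, pres8_add_of_eq hd₂ (k := k) (by omega) (by rw [← padicPlace_v, ← padicPlace_v, hvnn]; exact hk1),
        h2k, zero_mul, add_zero]
    rw [hr₁, hr₃] at hprod
    rw [p0 (by rw [hv₁]; exact heven), p0 heven, mul_zero, add_zero, pc4, aux_A r hrr hprod]
  · -- Case `v₂(x) = 0`
    have hv₁ : 𝔳.v (x - -N) = 0 := by
      rw [hx₁, ← hzero]; exact (𝔳.add_eq_left_of_lt hd₂ hN0 (by rw [hvn]; omega)).2
    have hr₁ : pres8 (x - -N) = r + 2 * s := by
      rw [hx₁, pres8_add_of_eq hd₂ le_rfl (by rw [← padicPlace_v, ← padicPlace_v, hvn, ← hv, hzero]; rfl),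
        hrn, pow_one]
    have hr₃ : pres8 (x - N) = r + 2 * (((-1 : ℤ) : ZMod (2 ^ 3)) * s) := by
      rw [hx₃, pres8_add_of_eq hd₂ le_rfl (by rw [← padicPlace_v, ← padicPlace_v, hvnn, ← hv, hzero]; rfl),
        hrnn, pow_one]
    rw [hr₁, hr₃] at hprod
    rw [p0 (by rw [hv₁]; exact ⟨0, rfl⟩), p0 (by rw [← hv, hzero]; exact ⟨0, rfl⟩), mul_zero, add_zero, pc4,
      aux_B r s hrr hss hprod]
  · by_cases hone : v = 1
    · -- Case `v₂(x) = 1`: one of `x ± n` has valuation `2`, the other odd valuation `≥ 3`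
      have hge₁ : (1 : ℤ) ≤ 𝔳.v (x - -N) := by
        have := 𝔳.le_add_or (a := x) (b := N) (c := 1) (Or.inr (by omega)) (Or.inr (by rw [hvn]))
        rw [hx₁]; exact this.resolve_left (by rw [← hx₁]; exact hd₁)
      have hge₃ : (1 : ℤ) ≤ 𝔳.v (x - N) := by
        have := 𝔳.le_add_or (a := x) (b := -N) (c := 1) (Or.inr (by omega)) (Or.inr (by rw [hvnn]))
        rw [hx₃]; exact this.resolve_left (by rw [← hx₃]; exact hd₃)
      rw [hone] at hsum
      -- `(x + n) - (x - n) = 2n` has valuation `2`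
      have h2n : (x - -N) + (-(x - N)) = (2 : ℚ_[2]) * N := by ring
      have h2v : 𝔳.v (2 : ℚ_[2]) = 1 := by
        rw [h𝔳, padicPlace_v, show (2 : ℚ_[2]) = ((2 : ℕ) : ℚ_[2]) by norm_num, Padic.valuation_p]
      have hv2n : 𝔳.v ((x - -N) + (-(x - N))) = 2 := by
        rw [h2n, 𝔳.v_mul two_ne_zero hN0, hvn, h2v]; norm_num
      have hne : 𝔳.v (x - -N) ≠ 𝔳.v (x - N) := by
        intro heq; rw [heq] at hsum; obtain ⟨k, hk⟩ := hsum; omega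
      rcases lt_or_gt_of_ne hne with hlt | hgt
      · -- `v(x+n) < v(x-n)`: then `v(x+n) = 2`
        have hv₁ : 𝔳.v (x - -N) = 2 := by
          rw [← hv2n]
          exact (𝔳.add_eq_left_of_lt hd₁ (neg_ne_zero.mpr hd₃) (by rw [𝔳.v_neg]; exact hlt)).2.symm
        have hodd₃ : Odd (𝔳.v (x - N)) := by
          obtain ⟨k, hk⟩ := hsum; exact ⟨k - 2, by omega⟩
        obtain ⟨k, hk, hk2⟩ : ∃ k : ℕ, 𝔳.v (x - N) = 𝔳.v N + k ∧ 2 ≤ k :=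
          ⟨(𝔳.v (x - N) - 1).toNat, by rw [hvn]; omega, by omega⟩
        have hrx : r = s + 4 * (2 ^ (k - 2) * pres8 (x - N)) := by
          have hxe : pres8 x = pres8 (N + (x - N)) := by congr 1; ring
          rw [hr, hxe, pres8_add_of_eq hN0 (k := k) (by omega) hk, hrn, two_pow_eq_four_mul hk2, mul_assoc]
        rw [p0 (by rw [hv₁]; exact ⟨1, rfl⟩), p1 (by rw [← hv, hone]; exact odd_one), mul_one, pc4, ← hr, hrx,
          aux_C2 s _ hss, ← hcm, ZModModule.add_self]
      · -- `v(x-n) < v(x+n)`: then `v(x-n) = 2`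
        have hv₃ : 𝔳.v (x - N) = 2 := by
          have := (𝔳.add_eq_left_of_lt (neg_ne_zero.mpr hd₃) hd₁ (by rw [𝔳.v_neg]; exact hgt)).2
          rw [add_comm, 𝔳.v_neg] at this; rw [← hv2n]; exact this.symm
        have hodd₁ : Odd (𝔳.v (x - -N)) := by
          obtain ⟨k, hk⟩ := hsum; exact ⟨k - 2, by omega⟩
        obtain ⟨k, hk, hk2⟩ : ∃ k : ℕ, 𝔳.v (x - -N) = 𝔳.v (-N) + k ∧ 2 ≤ k :=
          ⟨(𝔳.v (x - -N) - 1).toNat, by rw [hvnn]; omega, by omega⟩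
        have hrx : r = ((-1 : ℤ) : ZMod (2 ^ 3)) * s + 4 * (2 ^ (k - 2) * pres8 (x - -N)) := by
          have hxe : pres8 x = pres8 (-N + (x - -N)) := by congr 1; ring
          rw [hr, hxe, pres8_add_of_eq hNn0 (k := k) (by omega) hk, hrnn, two_pow_eq_four_mul hk2, mul_assoc]
        rw [p1 hodd₁, p1 (by rw [← hv, hone]; exact odd_one), mul_one, pc4, ← hr, hrx, aux_C1 s _ hss, ← hcm,
          add_assoc, ZModModule.add_self, add_zero]
    · -- Case `v₂(x) ≥ 2`
      have hv2 : (2 : ℤ) ≤ v := by omega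
      have hv₁ : 𝔳.v (x - -N) = 1 := by
        rw [hx₁, add_comm, ← hvn]
        exact (𝔳.add_eq_left_of_lt hN0 hd₂ (by rw [hvn]; omega)).2
      have hv₃ : 𝔳.v (x - N) = 1 := by
        rw [hx₃, add_comm, ← hvnn]
        exact (𝔳.add_eq_left_of_lt hNn0 hd₂ (by rw [hvnn]; omega)).2
      rw [hv₁, hv₃] at hsum
      have heven : Even v := by obtain ⟨k, hk⟩ := hsum; exact ⟨k - 1, by omega⟩
      obtain ⟨k, hk⟩ : ∃ k : ℕ, v = 1 + k ∧ 1 ≤ k := ⟨(v - 1).toNat, by omega, by omega⟩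
      have hr₁ : pres8 (x - -N) = s + 2 ^ k * r := by
        rw [hx₁, add_comm, pres8_add_of_eq hN0 (k := k) hk.2
          (by rw [← padicPlace_v, ← padicPlace_v, hvn, ← h𝔳, ← hv]; exact_mod_cast hk.1), hrn]
      have hr₃ : pres8 (x - N) = ((-1 : ℤ) : ZMod (2 ^ 3)) * s + 2 ^ k * r := by
        rw [hx₃, add_comm, pres8_add_of_eq hNn0 (k := k) hk.2
          (by rw [← padicPlace_v, ← padicPlace_v, hvnn, ← h𝔳, ← hv]; exact_mod_cast hk.1), hrnn]
      rw [hr₁, hr₃] at hprod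
      rw [p1 (by rw [hv₁]; exact odd_one), p0 heven, mul_zero, add_zero, pc4, ← hr]
      have hkodd : k = 1 ∨ 3 ≤ k := by obtain ⟨j, hj⟩ := heven; omega
      rcases hkodd with rfl | hk3
      · rw [pow_one] at hprod
        exact (aux_D1 r s hrr hss hprod).symm ▸ rfl
      · have h2k : (2 : ZMod (2 ^ 3)) ^ k = 0 := by
          obtain ⟨j, rfl⟩ := Nat.exists_eq_add_of_le hk3
          rw [pow_add, show (2 : ZMod (2 ^ 3)) ^ 3 = 0 from rfl, zero_mul]
        rw [h2k, zero_mul, add_zero, add_zero] at hprod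
        exact (aux_D2 r s hrr hss hprod).symm ▸ rfl

/-! ## The relation on descent components, all points, read through a homomorphism into `ℚ₂` -/

/-- Square classes read in `ℚ₂`: equal classes in `F` have equal `2`-adic parity and `χ₄` bits after any
ring homomorphism `φ : F → ℚ₂`. [cite: SilvermanAEC2009, Example X.1.5] -/
theorem parity_pc4_eq_of_sqClass_eq {F : Type*} [Field F] (φ : F →+* ℚ_[2]) {a r : F} (ha : a ≠ 0)
    (hr : r ≠ 0) (h : sqClass a = sqClass r) :
    (padicPlace 2).parity (φ a) = (padicPlace 2).parity (φ r) ∧ pc4 (φ a) = pc4 (φ r) := by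
  rw [sqClass_of_ne_zero ha] at h
  obtain ⟨t, ht0, hrt⟩ := exists_eq_mul_sq_of_mk_eq_sqClass hr h
  rw [Units.val_mk0] at hrt
  have hφa : φ a ≠ 0 := (map_ne_zero φ).mpr ha
  have hφt : φ t ≠ 0 := (map_ne_zero φ).mpr ht0
  rw [hrt, map_mul, map_pow]
  constructor
  · rw [(padicPlace 2).parity_mul hφa (pow_ne_zero 2 hφt), (padicPlace 2).parity_sq hφt, add_zero]
  · rw [pc4_mul hφa (pow_ne_zero 2 hφt), sq, pc4_mul hφt hφt, ZModModule.add_self, add_zero]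

/-- Bits of `1 ∈ ℚ₂`. [cite: SilvermanAEC2009, Example X.1.5] -/
theorem parity_pc4_one : (padicPlace 2).parity (1 : ℚ_[2]) = 0 ∧ pc4 (1 : ℚ_[2]) = 0 := by
  haveI : Fact (Nat.Prime 2) := ⟨Nat.prime_two⟩
  refine ⟨((padicPlace 2).parity_eq_zero_iff 1).mpr (by rw [(padicPlace 2).v_one]; exact ⟨0, rfl⟩), ?_⟩
  rw [show (1 : ℚ_[2]) = ((1 : ℚ) : ℚ_[2]) by norm_num, pc4_ratCast, chi4_one]

/-- Two checks in `ℤ/2` behind the torsion cases. [folklore] -/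
private theorem zmod2_cn_aux : (∀ c : ZMod 2, (1 : ZMod 2) = 1 + c + c * 1) ∧ (∀ c : ZMod 2, (0 : ZMod 2) = c + c * 1) := by
  refine ⟨by decide, by decide⟩

/-- Transport of `resPow` along an equality of primes (for `ℚ_[primesEquiv v]` with `primesEquiv v = 2`).
[cite: SilvermanAEC2009, Example X.1.5] -/
theorem resPow_val_congr {ℓ ℓ' : ℕ} [Fact ℓ.Prime] [Fact ℓ'.Prime] (h : ℓ = ℓ') (k : ℕ) (b : ℚ) :
    (resPow ℓ k b).val = (resPow ℓ' k b).val := by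
  subst h; rfl

/-- **The `2`-adic condition on descent components, all points** (Silverman AEC Example X.1.5 / Prop. X.1.4
at `p = 2` for `y² = (x + n) x (x − n)`, `n = 2m`, `m` odd): let `F` be a field with a ring homomorphism
`φ : F →+* ℚ_p`, `p = 2`, `E/F` a curve with rational `2`-torsion `e₁, e₂, e₃` mapping to `−n, 0, n`, and let
`a, b ∈ F`, non-zero, represent the `T₁`- and `T₂`-descent components of a point `P ∈ E(F)` (`O` and the
`2`-torsion included). Then `parity₂(φ a) = χ₄(φ b) + χ₄(m)·parity₂(φ b)`. (Stated for a prime `p` with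
`p = 2` so that it applies to `ℚ_[primesEquiv v]`.) [cite: SilvermanAEC2009, Example X.1.5, Prop. X.1.4] -/
theorem local_condition_two_cn_of_twoDescentComponent_eq
    {F : Type*} [Field F] [CharZero F] (φ : F →+* ℚ_[2]) {m : ℤ} (hm : Odd m) {n : ℚ} (hn : n = 2 * m)
    {W : WeierstrassCurve.Affine F} [W.IsElliptic] {e₁ e₂ e₃ : F} (hW : W.SplitTwoTorsion e₁ e₂ e₃)
    (he₁ : φ e₁ = -(n : ℚ_[2])) (he₂ : φ e₂ = 0) (he₃ : φ e₃ = (n : ℚ_[2])) (P : W.Point) {a b : F}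
    (ha : a ≠ 0) (hb : b ≠ 0) (hPa : twoDescentComponent W e₁ e₂ e₃ P = sqClass a)
    (hPb : twoDescentComponent W e₂ e₁ e₃ P = sqClass b) :
    (padicPlace 2).parity (φ a) = pc4 (φ b) + chi4 (m : ℚ) * (padicPlace 2).parity (φ b) := by
  haveI : Fact (Nat.Prime 2) := ⟨Nat.prime_two⟩
  have hm2 : ¬ (2 : ℤ) ∣ m := by rcases hm with ⟨k, rfl⟩; omega
  have hm0 : (m : ℚ) ≠ 0 := by exact_mod_cast (show m ≠ 0 by rintro rfl; exact hm2 ⟨0, rfl⟩)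
  have hn0 : n ≠ 0 := by rw [hn]; exact mul_ne_zero two_ne_zero hm0
  -- rational `2`-adic data of the constants
  have hvm : padicValRat 2 (m : ℚ) = 0 := padicValRat_intCast_eq_zero (by exact_mod_cast hm2)
  have hvn : padicValRat 2 n = 1 := by
    rw [hn, padicValRat.mul two_ne_zero hm0, hvm, show (2 : ℚ) = ((2 : ℕ) : ℚ) from rfl,
      padicValRat.self one_lt_two]; rfl
  have kv₁ : parityBit 2 ((-n - 0) * (-n - n)) = 1 := by
    refine parityBit_eq_one_of_odd ?_
    rw [show (-n - 0) * (-n - n) = 2 * (n * n) by ring, padicValRat.mul two_ne_zero (mul_ne_zero hn0 hn0),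
      padicValRat.mul hn0 hn0, hvn, show (2 : ℚ) = ((2 : ℕ) : ℚ) from rfl, padicValRat.self one_lt_two]
    decide
  have kv₂ : parityBit 2 (-n - 0) = 1 := by
    refine parityBit_eq_one_of_odd ?_; rw [sub_zero, padicValRat.neg, hvn]; exact odd_one
  have kv₃ : parityBit 2 ((0 : ℚ) - -n) = 1 := by
    refine parityBit_eq_one_of_odd ?_; rw [zero_sub, neg_neg, hvn]; exact odd_one
  have kv₄ : parityBit 2 (((0 : ℚ) - -n) * (0 - n)) = 0 := by
    refine parityBit_eq_zero_of_even ?_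
    rw [show ((0 : ℚ) - -n) * (0 - n) = -(n * n) by ring, padicValRat.neg, padicValRat.mul hn0 hn0, hvn]
    exact ⟨1, rfl⟩
  have kv₅ : parityBit 2 (n - -n) = 0 := by
    refine parityBit_eq_zero_of_even ?_
    rw [show n - -n = 2 * n by ring, padicValRat.mul two_ne_zero hn0, hvn,
      show (2 : ℚ) = ((2 : ℕ) : ℚ) from rfl, padicValRat.self one_lt_two]
    exact ⟨1, rfl⟩
  have kv₆ : parityBit 2 (n - 0) = 1 := by
    refine parityBit_eq_one_of_odd ?_; rw [sub_zero, hvn]; exact odd_one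
  have kc₂ : chi4 (-n - 0) = 1 + chi4 (m : ℚ) := by
    rw [sub_zero, hn, show -((2 : ℚ) * m) = (2 : ℚ) ^ (1 : ℤ) * ((-1 : ℚ) * m) by ring, chi4_two_zpow_mul,
      chi4_mul (by norm_num) hm0, chi4_neg_one]
  have kc₄ : chi4 (((0 : ℚ) - -n) * (0 - n)) = 1 := by
    rw [show ((0 : ℚ) - -n) * (0 - n) = (-1 : ℚ) * n ^ 2 by ring, chi4_mul (by norm_num) (pow_ne_zero 2 hn0),
      chi4_neg_one, chi4_sq, add_zero]
  have kc₆ : chi4 (n - 0) = chi4 (m : ℚ) := by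
    rw [sub_zero, hn, show (2 : ℚ) * m = (2 : ℚ) ^ (1 : ℤ) * (m : ℚ) by ring, chi4_two_zpow_mul]
  -- bits of rational constants read in `ℚ₂`
  have ratbits : ∀ q : ℚ, (padicPlace 2).parity ((q : ℚ_[2])) = parityBit 2 q ∧ pc4 ((q : ℚ_[2])) = chi4 q :=
    fun q => ⟨padicPlace_parity_ratCast 2 q, pc4_ratCast q⟩
  have hφn : φ (n : F) = (n : ℚ_[2]) := map_ratCast φ n
  -- the torsion abscissae in `F`
  have hE₁ : e₁ = -(n : F) := φ.injective (by rw [he₁, map_neg, hφn])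
  have hE₂ : e₂ = 0 := φ.injective (by rw [he₂, _root_.map_zero])
  have hE₃ : e₃ = (n : F) := φ.injective (by rw [he₃, hφn])
  subst hE₁ hE₂ hE₃
  obtain ⟨auxT₁, auxT₃⟩ := zmod2_cn_aux
  rcases P with _ | ⟨x, y, hxy⟩
  · -- `P = O`
    rw [← zero_def, twoDescentComponent_zero, eq_comm] at hPa hPb
    have hPa' : sqClass a = sqClass (1 : F) := by rw [hPa, ← mul_one (1 : F), sqClass_mul_self]
    have hPb' : sqClass b = sqClass (1 : F) := by rw [hPb, ← mul_one (1 : F), sqClass_mul_self]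
    obtain ⟨pa, ca⟩ := parity_pc4_eq_of_sqClass_eq φ ha one_ne_zero hPa'
    obtain ⟨pb, cb⟩ := parity_pc4_eq_of_sqClass_eq φ hb one_ne_zero hPb'
    rw [map_one] at pa ca pb cb
    rw [pa, pb, cb, parity_pc4_one.1, parity_pc4_one.2, mul_zero, add_zero]
  by_cases hx₁ : x = -(n : F)
  · -- `P = T₁`
    rw [twoDescentComponent_some_of_eq hxy hx₁, eq_comm] at hPa
    rw [twoDescentComponent_some_of_ne hxy (by rw [hx₁]; exact hW.ne₁₂), eq_comm, hx₁] at hPb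
    obtain ⟨pa, -⟩ := parity_pc4_eq_of_sqClass_eq φ ha hW.c_ne_zero hPa
    obtain ⟨pb, cb⟩ := parity_pc4_eq_of_sqClass_eq φ hb (sub_ne_zero.mpr hW.ne₁₂) hPb
    have e1 : φ ((-(n : F) - 0) * (-(n : F) - n)) = (((-n - 0) * (-n - n) : ℚ) : ℚ_[2]) := by
      rw [map_mul, map_sub, map_sub, map_neg, _root_.map_zero, hφn]; push_cast; ring
    have e2 : φ (-(n : F) - 0) = (((-n - 0) : ℚ) : ℚ_[2]) := by
      rw [map_sub, map_neg, _root_.map_zero, hφn]; push_cast; ring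
    rw [pa, pb, cb, e1, e2, (ratbits _).1, (ratbits _).1, (ratbits _).2, kv₁, kv₂, kc₂]
    exact auxT₁ _
  by_cases hx₂ : x = 0
  · -- `P = T₂`
    rw [twoDescentComponent_some_of_ne hxy hx₁, eq_comm, hx₂] at hPa
    rw [twoDescentComponent_some_of_eq hxy hx₂, eq_comm] at hPb
    obtain ⟨pa, -⟩ := parity_pc4_eq_of_sqClass_eq φ ha (sub_ne_zero.mpr (Ne.symm hW.ne₁₂)) hPa
    obtain ⟨pb, cb⟩ := parity_pc4_eq_of_sqClass_eq φ hb hW.swap₁₂.c_ne_zero hPb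
    have e1 : φ ((0 : F) - -(n : F)) = ((((0 : ℚ) - -n) : ℚ) : ℚ_[2]) := by
      rw [map_sub, map_neg, _root_.map_zero, hφn]; push_cast; ring
    have e2 : φ (((0 : F) - -(n : F)) * (0 - n)) = (((((0 : ℚ) - -n) * (0 - n)) : ℚ) : ℚ_[2]) := by
      rw [map_mul, map_sub, map_sub, map_neg, _root_.map_zero, hφn]; push_cast; ring
    rw [pa, pb, cb, e1, e2, (ratbits _).1, (ratbits _).1, (ratbits _).2, kv₃, kv₄, kc₄, mul_zero, add_zero]
  -- `x ≠ e₁, e₂`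
  rw [twoDescentComponent_some_of_ne hxy hx₁, eq_comm] at hPa
  rw [twoDescentComponent_some_of_ne hxy hx₂, eq_comm] at hPb
  obtain ⟨pa, -⟩ := parity_pc4_eq_of_sqClass_eq φ ha (sub_ne_zero.mpr hx₁) hPa
  obtain ⟨pb, cb⟩ := parity_pc4_eq_of_sqClass_eq φ hb (sub_ne_zero.mpr hx₂) hPb
  have hsq := sq_eq_mul_mul_of_equation hW hxy.1
  by_cases hy : y + (W.a₁ * x + W.a₃) / 2 = 0
  · -- `P = T₃`: `x = n`
    rw [hy, zero_pow two_ne_zero, eq_comm, mul_eq_zero, mul_eq_zero] at hsq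
    have hx₃ : x = (n : F) := by
      rcases hsq with (h0 | h0) | h0
      · exact absurd (sub_eq_zero.mp h0) hx₁
      · exact absurd (sub_eq_zero.mp h0) hx₂
      · exact sub_eq_zero.mp h0
    rw [hx₃] at pa pb cb
    have e1 : φ ((n : F) - -(n : F)) = (((n - -n) : ℚ) : ℚ_[2]) := by
      rw [map_sub, map_neg, hφn]; push_cast; ring
    have e2 : φ ((n : F) - 0) = (((n - 0) : ℚ) : ℚ_[2]) := by
      rw [map_sub, _root_.map_zero, hφn]; push_cast; ring
    rw [pa, pb, cb, e1, e2, (ratbits _).1, (ratbits _).1, (ratbits _).2, kv₅, kv₆, kc₆]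
    exact auxT₃ _
  · -- generic point: the `ℚ₂`-point `(φ x, φ y')`
    have hsq' := congrArg φ hsq
    rw [map_pow, map_mul, map_mul, map_sub, map_sub, map_sub, map_neg, _root_.map_zero, hφn] at hsq'
    have hy' : φ (y + (W.a₁ * x + W.a₃) / 2) ≠ 0 := (map_ne_zero φ).mpr hy
    have key := local_condition_two_cn_padic hm hn hsq' hy'
    rw [pa, pb, cb, map_sub, map_sub, map_neg, _root_.map_zero, hφn]
    exact key

/-- **The same for a prime `p` with `p = 2`** (so that it applies to Mathlib's `ℚ_[primesEquiv v]` at the place of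
`ℚ` over `2`), the `χ₄`-bit written through `(presPow p 3 ·).val`. [cite: SilvermanAEC2009, Example X.1.5, Prop. X.1.4] -/
theorem local_condition_two_cn_of_twoDescentComponent_eq_of_eq_two {p : ℕ} [Fact p.Prime] (hp : p = 2)
    {F : Type*} [Field F] [CharZero F] (φ : F →+* ℚ_[p]) {m : ℤ} (hm : Odd m) {n : ℚ} (hn : n = 2 * m)
    {W : WeierstrassCurve.Affine F} [W.IsElliptic] {e₁ e₂ e₃ : F} (hW : W.SplitTwoTorsion e₁ e₂ e₃)
    (he₁ : φ e₁ = -(n : ℚ_[p])) (he₂ : φ e₂ = 0) (he₃ : φ e₃ = (n : ℚ_[p])) (P : W.Point) {a b : F}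
    (ha : a ≠ 0) (hb : b ≠ 0) (hPa : twoDescentComponent W e₁ e₂ e₃ P = sqClass a)
    (hPb : twoDescentComponent W e₂ e₁ e₃ P = sqClass b) :
    (padicPlace p).parity (φ a) =
      chi4Of (((presPow p 3 (φ b)).val : ℕ) : ZMod (2 ^ 3)) + chi4 (m : ℚ) * (padicPlace p).parity (φ b) := by
  subst hp
  rw [ZMod.natCast_zmod_val]
  exact local_condition_two_cn_of_twoDescentComponent_eq φ hm hn hW he₁ he₂ he₃ P ha hb hPa hPb

end Literature.NumberTheory.EllipticCurves.TwoDescentLocal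

/-! ## Selmer classes over `ℚ`: the `2`-adic relation -/

open Field IsDedekindDomain NumberField Rat.HeightOneSpectrum

universe u

namespace WeierstrassCurve

open Literature.NumberTheory.GaloisRepresentations Literature.NumberTheory.EllipticCurves
open Literature.NumberTheory.EllipticCurves.TwoDescentLocal Literature.NumberTheory.EllipticCurves.KramerTwoDescent
open WeierstrassCurve.Affine

/-- **The `2`-adic relation on Selmer classes of `y² = (x + n) x (x − n)`, `n = 2m`, `m` odd** (Silverman AEC
Example X.1.5 / Prop. X.4.9 at `p = 2`): for `E/ℚ` with rational `2`-torsion `−n, 0, n` and `c ∈ Sel⁽²⁾(E/ℚ)`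
with global `T₁`-component `[a]` and `T₂`-component `[b]` (`a, b ∈ ℚˣ`):
`parityBit 2 a = chi4 b + chi4 m · parityBit 2 b`. [cite: SilvermanAEC2009, Example X.1.5, Prop. X.1.4, Prop. X.4.9] -/
theorem parityBit_two_eq_of_mem_selmerGroup_cn (W : WeierstrassCurve ℚ) [W.IsElliptic] {m : ℤ} (hm : Odd m)
    {n : ℚ} (hn : n = 2 * m) (h : W.toAffine.SplitTwoTorsion (-n) 0 n) {c : galH1Torsion W 2}
    (hc : c ∈ selmerGroup W 2) (a b : ℚˣ)
    (ha : kummerEquiv ℚ 2 (W.twoTorsionCharH1 h c) = Additive.ofMul (QuotientGroup.mk a))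
    (hb : kummerEquiv ℚ 2 (W.twoTorsionCharH1 h.swap₁₂ c) = Additive.ofMul (QuotientGroup.mk b)) :
    parityBit 2 (a : ℚ) = chi4 (b : ℚ) + chi4 (m : ℚ) * parityBit 2 (b : ℚ) := by
  set v : HeightOneSpectrum (𝓞 ℚ) := primesEquiv.symm ⟨2, Nat.prime_two⟩ with hv
  haveI := fact_prime_primesEquiv v
  have hℓ : (primesEquiv v : ℕ) = 2 := by rw [hv, Equiv.apply_symm_apply]
  haveI : CharZero (Place.Completion (Sum.inr v : Place ℚ)) :=
    charZero_of_injective_algebraMap (algebraMap ℚ (v.adicCompletion ℚ)).injective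
  haveI : (W.baseChange (Place.Completion (Sum.inr v : Place ℚ))).IsElliptic := W.isElliptic_baseChange _
  haveI : (W.baseChange (v.adicCompletion ℚ)).IsElliptic := W.isElliptic_baseChange _
  obtain ⟨P, hP₁, hP₂⟩ :=
    W.exists_twoDescentComponent_pair_eq_of_mem_selmerGroup h hc (Sum.inr v : Place ℚ) a b ha hb
  have ha0 : algebraMap ℚ (v.adicCompletion ℚ) (a : ℚ) ≠ 0 := by
    rw [map_ne_zero_iff _ (algebraMap ℚ (v.adicCompletion ℚ)).injective]; exact a.ne_zero
  have hb0 : algebraMap ℚ (v.adicCompletion ℚ) (b : ℚ) ≠ 0 := by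
    rw [map_ne_zero_iff _ (algebraMap ℚ (v.adicCompletion ℚ)).injective]; exact b.ne_zero
  have hPa : twoDescentComponent (W.baseChange (v.adicCompletion ℚ)).toAffine
      (algebraMap ℚ (v.adicCompletion ℚ) (-n)) (algebraMap ℚ (v.adicCompletion ℚ) 0)
      (algebraMap ℚ (v.adicCompletion ℚ) n) P = sqClass (algebraMap ℚ (v.adicCompletion ℚ) (a : ℚ)) :=
    hP₁.trans (mk_unitsMap_eq_sqClass (E' := v.adicCompletion ℚ) a)
  have hPb : twoDescentComponent (W.baseChange (v.adicCompletion ℚ)).toAffine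
      (algebraMap ℚ (v.adicCompletion ℚ) 0) (algebraMap ℚ (v.adicCompletion ℚ) (-n))
      (algebraMap ℚ (v.adicCompletion ℚ) n) P = sqClass (algebraMap ℚ (v.adicCompletion ℚ) (b : ℚ)) :=
    hP₂.trans (mk_unitsMap_eq_sqClass (E' := v.adicCompletion ℚ) b)
  have hsplit := h.map (v.adicCompletion ℚ)
  set φ : v.adicCompletion ℚ →+* ℚ_[primesEquiv v] :=
    (adicCompletion.padicEquiv v).toAlgEquiv.toRingEquiv.toRingHom with hφ
  have hφq : ∀ q : ℚ, φ (algebraMap ℚ (v.adicCompletion ℚ) q) = (q : ℚ_[primesEquiv v]) := by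
    intro q
    rw [hφ, RingEquiv.toRingHom_eq_coe, RingHom.coe_coe, AlgEquiv.coe_ringEquiv, AlgEquiv.commutes, eq_ratCast]
  have he₁ : φ (algebraMap ℚ (v.adicCompletion ℚ) (-n)) = -(n : ℚ_[primesEquiv v]) := by
    rw [hφq]; push_cast; ring
  have he₂ : φ (algebraMap ℚ (v.adicCompletion ℚ) 0) = 0 := by rw [hφq]; push_cast; ring
  have he₃ : φ (algebraMap ℚ (v.adicCompletion ℚ) n) = (n : ℚ_[primesEquiv v]) := hφq n
  haveI : CharZero (v.adicCompletion ℚ) :=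
    charZero_of_injective_algebraMap (algebraMap ℚ (v.adicCompletion ℚ)).injective
  have key := local_condition_two_cn_of_twoDescentComponent_eq_of_eq_two hℓ φ hm hn hsplit he₁ he₂ he₃ P ha0 hb0
    hPa hPb
  rw [hφq, hφq, padicPlace_parity_ratCast, padicPlace_parity_ratCast, presPow_ratCast] at key
  haveI : Fact (Nat.Prime 2) := ⟨Nat.prime_two⟩
  rw [resPow_val_congr hℓ] at key
  simp only [hℓ] at key
  rw [ZMod.natCast_zmod_val] at key
  exact key

end WeierstrassCurve

end
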